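import Mathlib
import Literature.Computability.AlgebraicComplexity.MignonRessayreBound
import Summits.ValiantsHypothesis.ValiantsHypothesis.Theorems.GrenetZeonTwoDimCoefficientsScalingRayDiscCount

/-!
# Crux `GrenetZeon.TwoDimCoefficients` (stmt-ValiantsHypothesis-8062), stub `stub_dualUnipotent`:
# scaling-closure — `n³ ≤ 2m²` from a SEPARABILITY CERTIFICATE of the ray polynomial (3/2 rung, generic-point step typed)

The counting step R9 of memo SEVENTEENTH-HAND.md.  Let `R(t) = c + Σ_{k=1}^{J} Ψ_k·t^k ∈ ℂ[z][t]` be the ray polynomial of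
a unipotent dual representation with `deg D_k ≤ kn` and top companion order `J` (`Ψ_k = [D_k]_{kn}`, `Ψ_J ≠ 0`).  A
SEPARABILITY CERTIFICATE is `a·R + b·R′ = g` with `a, b ∈ ℂ[z][t]` and `0 ≠ g ∈ ℂ[z]` (it exists iff `R` is squarefree
over `ℂ(z)`, iff the shadow `Φ = R(z, 1)` is squarefree).  At a point `z₀` with `g(z₀)·Ψ_J(z₀)·det Hess per_n(z₀) ≠ 0`
(such points exist: the three polynomials are non-zero, ✓ `rank_mrHess` for the third) the specialised `R_{z₀}` has `J`
distinct simple non-zero roots, so ✓ `cube_le_two_mul_sq_of_simpleRayRoots` applies: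

* ★★ `cube_le_two_mul_sq_of_raySeparable` — separability certificate ⟹ `n³ ≤ 2m²`.

So the 3/2 rung (crux `DualUnipotentThreeHalves`, stmt-24318, constant 2) holds for every unipotent dual representation with
`deg D_k ≤ kn` (e.g. every index-`n` pencil, ✓ `hdeg_of_index`) whose ray polynomial is separable over `ℂ(z)`; the
residual is a repeated factor of the shadow (lemma L1′ of the memo) — and pencils violating `deg D_k ≤ kn`.

HONEST FRAMING: a conditional rung; the stub `DualUnipotentBound`, both cruxes and `VP ≠ VNP` remain open.

References: T. Mignon, N. Ressayre, Int. Math. Res. Not. 2004:79, Thm. 1.1 (via the tree); folklore.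
-/

-- single-conjunct layout `Summits/ValiantsHypothesis/ValiantsHypothesis`: the duplicated namespace
-- component is mandated by the tree.
set_option linter.dupNamespace false
set_option autoImplicit false

noncomputable section

namespace Summit.ValiantsHypothesis.ValiantsHypothesis.Theorems.GrenetZeonTwoDimCoefficients.ScalingClosure

open MvPolynomial Matrix
open Literature.Computability.AlgebraicComplexity
open Summit.ValiantsHypothesis.ValiantsHypothesis.Cruxes.TwoDimCoefficients.DimTwoCases

section Separable

variable {n m : ℕ}

/-- **The permanent's Hessian is generically non-degenerate**: the determinant of the matrix of second partials of
`per_{k+3}` is a non-zero polynomial (it does not vanish at the Mignon–Ressayre point, ✓ `rank_mrHess`). [cite: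
MignonRessayre2004, Thm. 1.1 — via the tree] -/
theorem det_hessianMatrix_perPoly_ne_zero (k : ℕ) :
    (Matrix.of fun s t : Fin (k + 3) × Fin (k + 3) =>
      pderiv s (pderiv t (perPoly (Fin (k + 3)) ℂ))).det ≠ 0 := by
  classical
  intro h0
  have hH : hess0 (transl (mrPoint ℂ k) (perPoly (Fin (k + 3)) ℂ)) =
      (MvPolynomial.eval (mrPoint ℂ k)).mapMatrix
        (Matrix.of fun s t : Fin (k + 3) × Fin (k + 3) => pderiv s (pderiv t (perPoly (Fin (k + 3)) ℂ))) := by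
    ext s t
    rw [hess0_transl, RingHom.mapMatrix_apply, Matrix.map_apply, Matrix.of_apply]
  have h := RingHom.map_det (MvPolynomial.eval (mrPoint ℂ k))
    (Matrix.of fun s t : Fin (k + 3) × Fin (k + 3) => pderiv s (pderiv t (perPoly (Fin (k + 3)) ℂ)))
  rw [h0, map_zero, ← hH, hess0_transl_mrPoint_perPoly, Matrix.det_smul] at h
  refine (mul_ne_zero (pow_ne_zero _ (Nat.cast_ne_zero.mpr (Nat.factorial_ne_zero k))) ?_) h.symm
  exact ((Matrix.isUnit_iff_isUnit_det _).mp
    (Matrix.mulVec_injective_iff_isUnit.mp mrHess_mulVec_injective)).ne_zero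

/-- Rank of the Hessian of `per_{k+3}` at a point where the Hessian determinant polynomial does not vanish. [folklore] -/
theorem rank_hess0_perPoly_eq_of_eval_det_ne_zero (k : ℕ) (z : Fin (k + 3) × Fin (k + 3) → ℂ)
    (hz : eval z (Matrix.of fun s t : Fin (k + 3) × Fin (k + 3) =>
      pderiv s (pderiv t (perPoly (Fin (k + 3)) ℂ))).det ≠ 0) :
    (hess0 (transl z (perPoly (Fin (k + 3)) ℂ))).rank = (k + 3) ^ 2 := by
  classical
  have hH : hess0 (transl z (perPoly (Fin (k + 3)) ℂ)) = (MvPolynomial.eval z).mapMatrix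
      (Matrix.of fun s t : Fin (k + 3) × Fin (k + 3) => pderiv s (pderiv t (perPoly (Fin (k + 3)) ℂ))) := by
    ext s t
    rw [hess0_transl, RingHom.mapMatrix_apply, Matrix.map_apply, Matrix.of_apply]
  have hu : IsUnit (hess0 (transl z (perPoly (Fin (k + 3)) ℂ))) := by
    rw [Matrix.isUnit_iff_isUnit_det, hH, ← RingHom.map_det]
    exact isUnit_iff_ne_zero.mpr hz
  rw [Matrix.rank_of_isUnit _ hu, Fintype.card_prod, Fintype.card_fin, sq]

/-- ★★ **`n³ ≤ 2m²` from a separability certificate of the ray polynomial** (`n = k + 3`).  Unipotent dual representation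
(`det A = c ≠ 0`, `per_n = α·c + β·tr(adj A·B)`, `A, B` affine `m × m`, `m ≥ 2`) with `deg D_j ≤ jn` (`j ≥ 2`), top companion
order `J ≥ 1` (`[D_J]_{Jn} ≠ 0`, `[D_j]_{jn} = 0` for `J < j ≤ m`), and polynomials `a, b ∈ ℂ[z][t]`, `0 ≠ g ∈ ℂ[z]` with
`a·R + b·R′ = g` for the ray polynomial `R = c + Σ_{e<J} [D_{e+1}]_{(e+1)n}·t^{e+1}` ⟹ `n³ ≤ 2m²`.
[cite: MignonRessayre2004, Thm. 1.1 — via the tree; folklore] -/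
theorem cube_le_two_mul_sq_of_raySeparable {k m : ℕ} (A B : AffMat (k + 3) m) (hA : IsAffine A) (hB : IsAffine B)
    (α β c : ℂ) (hc : c ≠ 0) (hβ : β ≠ 0) (hdet : A.det = MvPolynomial.C c)
    (hper : perPoly (Fin (k + 3)) ℂ =
      MvPolynomial.C α * A.det + MvPolynomial.C β * (A.adjugate * B).trace)
    (hm2 : 2 ≤ m) (D : ℕ → MvPolynomial (Fin (k + 3) × Fin (k + 3)) ℂ)
    (hD : ∀ j, D j = (det ((Polynomial.X : Polynomial (MvPolynomial (Fin (k + 3) × Fin (k + 3)) ℂ)) •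
      B.map Polynomial.C + A.map Polynomial.C)).coeff j)
    (hdeg : ∀ j, 2 ≤ j → ∀ d, j * (k + 3) < d → homogeneousComponent d (D j) = 0)
    {J : ℕ} (hJ1 : 1 ≤ J) (hJtop : homogeneousComponent (J * (k + 3)) (D J) ≠ 0)
    (hJ : ∀ j, J < j → j ≤ m → homogeneousComponent (j * (k + 3)) (D j) = 0)
    (a b : Polynomial (MvPolynomial (Fin (k + 3) × Fin (k + 3)) ℂ)) (g : MvPolynomial (Fin (k + 3) × Fin (k + 3)) ℂ)
    (hg : g ≠ 0)
    (hcert : a * (Polynomial.C (MvPolynomial.C c) + ∑ e : Fin J,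
        Polynomial.C (homogeneousComponent (((e : ℕ) + 1) * (k + 3)) (D (e + 1))) * Polynomial.X ^ ((e : ℕ) + 1)) +
      b * Polynomial.derivative (Polynomial.C (MvPolynomial.C c) + ∑ e : Fin J,
        Polynomial.C (homogeneousComponent (((e : ℕ) + 1) * (k + 3)) (D (e + 1))) * Polynomial.X ^ ((e : ℕ) + 1)) =
      Polynomial.C g) :
    (k + 3) ^ 3 ≤ 2 * m ^ 2 := by
  classical
  set Ψ : Fin J → MvPolynomial (Fin (k + 3) × Fin (k + 3)) ℂ := fun e =>
    homogeneousComponent (((e : ℕ) + 1) * (k + 3)) (D (e + 1)) with hΨ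
  set R : Polynomial (MvPolynomial (Fin (k + 3) × Fin (k + 3)) ℂ) :=
    Polynomial.C (MvPolynomial.C c) + ∑ e : Fin J, Polynomial.C (Ψ e) * Polynomial.X ^ ((e : ℕ) + 1) with hR
  obtain ⟨J', hJ'⟩ : ∃ J', J = J' + 1 := ⟨J - 1, by omega⟩
  -- the top companion is `Ψ ⟨J', _⟩`
  set eTop : Fin J := ⟨J', by omega⟩ with heTop
  have hΨtop : Ψ eTop = homogeneousComponent (J * (k + 3)) (D J) := by
    rw [hΨ]; simp only [heTop]; rw [← hJ']
  -- a good point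
  set Hdet := (Matrix.of fun s t : Fin (k + 3) × Fin (k + 3) =>
      pderiv s (pderiv t (perPoly (Fin (k + 3)) ℂ))).det with hHdet
  have hT : Hdet * g * Ψ eTop ≠ 0 :=
    mul_ne_zero (mul_ne_zero (det_hessianMatrix_perPoly_ne_zero k) hg) (by rw [hΨtop]; exact hJtop)
  obtain ⟨z₀, hz₀⟩ : ∃ z₀ : Fin (k + 3) × Fin (k + 3) → ℂ, eval z₀ (Hdet * g * Ψ eTop) ≠ 0 := by
    by_contra hall
    push Not at hall
    exact hT (MvPolynomial.funext fun z => by rw [hall z, map_zero])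
  rw [map_mul, map_mul] at hz₀
  obtain ⟨⟨hz1, hz2⟩, hz3⟩ := mul_ne_zero_iff.mp hz₀ |>.imp_left (mul_ne_zero_iff.mp)
  -- the specialised ray polynomial
  set Rz : Polynomial ℂ := Polynomial.C c + ∑ e : Fin J, Polynomial.C (eval z₀ (Ψ e)) * Polynomial.X ^ ((e : ℕ) + 1)
    with hRz
  have hmapR : R.map (MvPolynomial.eval z₀) = Rz := by
    rw [hR, hRz, Polynomial.map_add, Polynomial.map_C, MvPolynomial.eval_C, Polynomial.map_sum]
    congr 1
    exact Finset.sum_congr rfl fun e _ => by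
      rw [Polynomial.map_mul, Polynomial.map_pow, Polynomial.map_C, Polynomial.map_X]
  -- the specialised certificate
  have hcertz : a.map (MvPolynomial.eval z₀) * Rz + b.map (MvPolynomial.eval z₀) * Polynomial.derivative Rz =
      Polynomial.C (eval z₀ g) := by
    have h := congrArg (Polynomial.map (MvPolynomial.eval z₀)) hcert
    rw [Polynomial.map_add, Polynomial.map_mul, Polynomial.map_mul, ← Polynomial.derivative_map, hmapR,
      Polynomial.map_C] at h
    exact h
  -- evaluation formulas
  have hevalR : ∀ x : ℂ, Rz.eval x = c + ∑ e : Fin J, x ^ ((e : ℕ) + 1) * eval z₀ (Ψ e) := by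
    intro x
    rw [hRz, Polynomial.eval_add, Polynomial.eval_C, Polynomial.eval_finsetSum]
    congr 1
    exact Finset.sum_congr rfl fun e _ => by
      rw [Polynomial.eval_mul, Polynomial.eval_C, Polynomial.eval_pow, Polynomial.eval_X, mul_comm]
  have hevalR' : ∀ x : ℂ, x * (Polynomial.derivative Rz).eval x =
      ∑ e : Fin J, (((e : ℕ) + 1 : ℕ) : ℂ) * (x ^ ((e : ℕ) + 1) * eval z₀ (Ψ e)) := by
    intro x
    rw [hRz, Polynomial.derivative_add, Polynomial.derivative_C, zero_add, Polynomial.derivative_sum,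
      Polynomial.eval_finsetSum, Finset.mul_sum]
    refine Finset.sum_congr rfl fun e _ => ?_
    rw [Polynomial.derivative_C_mul_X_pow, Polynomial.eval_mul, Polynomial.eval_C, Polynomial.eval_pow,
      Polynomial.eval_X, Nat.add_sub_cancel, pow_succ]
    push_cast
    ring
  -- degree and roots of `Rz`
  have hRz0 : Rz ≠ 0 := by
    intro h
    have := hevalR 0
    rw [h, Polynomial.eval_zero] at this
    refine hc ?_
    rw [this]
    simp
  have hdegle : Rz.natDegree ≤ J := by
    rw [hRz]
    refine (Polynomial.natDegree_add_le _ _).trans (max_le (by simp) ?_)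
    refine Polynomial.natDegree_sum_le_of_forall_le _ _ fun e _ => ?_
    exact (Polynomial.natDegree_C_mul_X_pow_le _ _).trans (by omega)
  have hcoeffJ : Rz.coeff J = eval z₀ (Ψ eTop) := by
    rw [hRz, Polynomial.coeff_add, Polynomial.coeff_C, if_neg (by omega), zero_add, Polynomial.finsetSum_coeff,
      Finset.sum_eq_single eTop]
    · rw [Polynomial.coeff_C_mul_X_pow, heTop, if_pos (by simp [hJ'])]
    · intro e _ he
      rw [Polynomial.coeff_C_mul_X_pow, if_neg]
      intro h
      apply he
      ext
      simp [heTop]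
      omega
    · intro h; exact absurd (Finset.mem_univ _) h
  have hdegJ : Rz.natDegree = J :=
    Polynomial.natDegree_eq_of_le_of_coeff_ne_zero hdegle (by rw [hcoeffJ]; exact hz3)
  have hsep : Rz.Separable := by
    refine ⟨Polynomial.C (eval z₀ g)⁻¹ * a.map (MvPolynomial.eval z₀),
      Polynomial.C (eval z₀ g)⁻¹ * b.map (MvPolynomial.eval z₀), ?_⟩
    rw [mul_assoc, mul_assoc, ← mul_add, hcertz, ← Polynomial.C_mul, inv_mul_cancel₀ hz2, Polynomial.C_1]
  have hsplit : Rz.Splits := IsAlgClosed.splits Rz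
  have hcard : Rz.roots.toFinset.card = J := by
    rw [Multiset.toFinset_card_of_nodup (Polynomial.nodup_roots hsep), ← hsplit.natDegree_eq_card_roots, hdegJ]
  -- enumerate the roots
  set t : Fin J → ℂ := fun i => ((Rz.roots.toFinset.equivFin.symm (Fin.cast hcard.symm i)) : ℂ) with htdef
  have ht_inj : Function.Injective t := by
    intro i j hij
    have h := Subtype.ext hij
    have h2 := (Rz.roots.toFinset.equivFin.symm.injective h)
    exact Fin.cast_injective _ h2
  have ht_root : ∀ i, Rz.eval (t i) = 0 := by
    intro i
    have hmem : t i ∈ Rz.roots.toFinset := (Rz.roots.toFinset.equivFin.symm (Fin.cast hcard.symm i)).2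
    rw [Multiset.mem_toFinset, Polynomial.mem_roots hRz0] at hmem
    exact hmem
  have ht_simple : ∀ i, t i * (Polynomial.derivative Rz).eval (t i) ≠ 0 := by
    intro i
    refine mul_ne_zero ?_ ?_
    · intro h0
      have := ht_root i
      rw [h0, hevalR] at this
      simp only [ne_eq, Nat.add_eq_zero_iff, one_ne_zero, and_false, not_false_eq_true, zero_pow, zero_mul,
        Finset.sum_const_zero, add_zero] at this
      exact hc this
    · intro h0
      have h := congrArg (Polynomial.eval (t i)) hcertz
      rw [Polynomial.eval_add, Polynomial.eval_mul, Polynomial.eval_mul, ht_root i, h0, mul_zero, mul_zero,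
        add_zero, Polynomial.eval_C] at h
      exact hz2 h.symm
  -- apply the pointwise theorem
  refine cube_le_two_mul_sq_of_simpleRayRoots A B hA hB α β c hc hβ hdet hper (by omega) hm2 D hD hdeg hJ1
    hJtop hJ z₀ t ht_inj (fun i => ?_) (fun i => ?_) (rank_hess0_perPoly_eq_of_eval_det_ne_zero k z₀ hz1)
  · rw [← hevalR]; exact ht_root i
  · rw [← hevalR']; exact ht_simple i

end Separable

end Summit.ValiantsHypothesis.ValiantsHypothesis.Theorems.GrenetZeonTwoDimCoefficients.ScalingClosure

end
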